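import Summits.BirchSwinnertonDyer.BirchSwinnertonDyer.Theorems.ErratumRoadFiveValueByNormContinuity
import Summits.BirchSwinnertonDyer.BirchSwinnertonDyer.Theorems.ErratumRoadFiveOpenInputIMCSplit
import HarnessLib

/-!
# Route `ErratumRoadFive` (K2 at `p ≥ 5`), item 19061 `OpenInputIMC`: the glue of its five-child split
# with the H2 child `BDPValueCoreFramesAll` (item 19275) REPLACED by norm continuity at `𝟙` (VN_p)

Cell `bsd-stepL` (run/shared/lean/pub/bsd-stepL/), seat `bsd-stepL-bdp` (prover g11, 2026-08-26),
`--supports stmt-BirchSwinnertonDyer-19275`. Sequel to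
`Theorems/ErratumRoadFiveValueByNormContinuity.lean` (same seat: TARGET E ⟸ core + (VN_p); H2∃⁻ ⟸
(VN_p) + frames; H2∃⁻ ⟹ (VC_p) ⟹ (VN_p)), at CLASS ∕ ROUTE level. (VN_p) «norm continuity at `𝟙` at
the erratum data» is the INLINE section hypothesis `hVNall` (its text is the hypothesis `hVN` of the
companion file quantified over every pair; no definition).

## What this file proves (theorems only; no definition, no named fact, no `sorry`)

* `openInputOnTreeAt_of_r1Population_of_not_dvd_of_normContinuity_of_core`: route p2's open input
  on `R1Population ∩ Locus` from the value-free core H3 (`P2.IMCDivIntCoreFrameAtErratumData`, item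
  19270's text) + (VN_p) + imc-p1's 11 published + 5 cited named facts (p417457's with-value variant
  `openInputOnTreeAt_of_r1Population_of_not_dvd_of_imcDivIntFrameAtErratumData` fed by the companion
  file's `imcDivIntFrameAtErratumData_of_normContinuity_of_core`).
* **`openInputIMC_of_core_of_ramResidue_of_normContinuity_of_not_ram`**:
  `IMCDivAtErratumDataAll → OpenInputRamOffErratumLocus → (VN_p ∀ W p) → OpenInputNotRam →
  PublishedInputsIMCReduction → OpenInputIMC` — the term of the landed glue `openInputIMCOfChildren_holds`
  (p418364 + p417457) with `BDPValueCoreFramesAll` (an `R₀`-frame WITH value at every erratum datum)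
  replaced by the frame-free, unit-free, `R₀`-free (VN_p ∀).
* `bdpValueCoreFramesAll_of_normContinuity_of_frames` ∕ `normContinuity_of_bdpValueCoreFramesAll`:
  item 19275 ⟸ (VN_p ∀) + frame existence (H1∃⁻ ∀), and item 19275 ⟹ (VN_p ∀) — a restate of 19275
  to (VN_p ∀) loses nothing and asks strictly less (no `R₀`-integrality of a BDP element at a
  non-semistable `p ∥ N`, which is printed nowhere).

HONEST FRAMING: every theorem is an implication; (VN_p) is NOT discharged here (print: Cas18 Thm. 3.2
on semistable pairs; JIMJ18 Thms. 2.10–2.11 + BDP13 at `p ≥ 5` where BDP13's auxiliary sign condition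
holds — cell memo PROOF-BDP §28); the other children of 19061 are OPEN; nothing is booked; no pair of
class X11b is closed; no label or census count moves (T7).

References: [Castella2018] Camb. J. Math. 6 (2018) = arXiv:1704.06608, Thms. 2.3, 3.1–3.2, §5;
[Castella2018Exceptional] J. Inst. Math. Jussieu 17 (2018) = arXiv:1507.04260, Thms. 2.10–2.11;
[Castella2018Erratum] Thm. 1.1, (2.4); [Miller2011LMS] Def. 1.1.
-/


set_option autoImplicit false

noncomputable section

open scoped Classical Topology

open Filter WeierstrassCurve NumberField IsDedekindDomain Field PowerSeries
open Literature.NumberTheory.EllipticCurves Literature.NumberTheory.EllipticCurves.GreenbergSelmer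
open Literature.NumberTheory.EllipticCurves.ModularForms
open Literature.NumberTheory.EllipticCurves.Rank1Residual
open Literature.NumberTheory.EllipticCurves.Rank1Residual.Typed
open Literature.NumberTheory.EllipticCurves.Castella2018
open Literature.NumberTheory.GaloisRepresentations
open Literature.NumberTheory.GaloisCohomology
open Summit.BirchSwinnertonDyer.Rank1Residual Summit.BirchSwinnertonDyer.Rank1Residual.X11b
open Summit.BirchSwinnertonDyer.Rank1Residual.X11b.Halves
open Summit.BirchSwinnertonDyer.BirchSwinnertonDyer.Theses

namespace Summit.BirchSwinnertonDyer.BirchSwinnertonDyer.Theorems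

/-! ### §3 On the route: the open input and item 19061's glue with H2 replaced by (VN_p) -/

section Route

variable
  (hVNall : ∀ (W : WeierstrassCurve ℚ) [W.IsElliptic] [W.IsGloballyMinimal] (p : ℕ) [Fact p.Prime],
    ∀ [NeZero (W.conductorNorm ℤ)] (q : ℕ) [Fact q.Prime] (K : Type) [Field K] [NumberField K]
    (Dt : ModularParametrizationData W (W.conductorNorm ℤ))
    (H : HeegnerDatum (W.conductorNorm ℤ) (NumberField.discr K)) (w₀ : InfinitePlace K)
    (P : (W.baseChange K).toAffine.Point), ErratumHypotheses W p → W.analyticRank = 1 →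
    q ≠ p → Mult W q → ¬ W.HasSplitMultiplicativeReductionAtPrime q →
    ¬ p ∣ padicValInt q W.minimalDiscriminantInt → IsErratumField W K q →
    Cas20Standing K p (W.conductorNorm ℤ / p) →
    WeierstrassCurve.Affine.Point.map w₀.embedding.toRatAlgHom P = heegnerPointComplex Dt H →
    ¬ (p : ℤ) ∣ Dt.c → ¬ IsOfFinAddOrder P →
    ∀ (κ : ZpExtension K p), κ.IsAnticyclotomic →
      ∀ (γ : Field.absoluteGaloisGroup K) [Fact (κ.IsTopGenerator γ)] (ι' : PadicAlgCl p ≃+* ℂ)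
        (e : K →+* ℚ_[p]),
        (∀ k : 𝓞 K, k ∈ (primeOfEmbeddingDatum p ι' w₀.embedding).asIdeal ↔ ‖e (k : K)‖ < 1) →
        ∃ (ΩK : ℂ) (Ωp : ℂ_[p]), ΩK ≠ 0 ∧ Ωp ≠ 0 ∧
          ∀ (φ : ℕ → HeckeCharacter K) (n : ℕ → ℕ) (r : ℕ → FramedGaloisRep K (PadicAlgCl p) 1),
            (∀ k, 0 < n k) → (∀ k (v : HeightOneSpectrum (𝓞 K)), (φ k).IsUnramifiedAt v) →
            (∀ k, (φ k).HasInfinityType (fun _ ↦ (n k : ℤ)) (fun _ ↦ -(n k : ℤ))) →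
            (∀ k, IsPAdicAvatarOf ι' (φ k) (r k)) → (∀ k, FactorsThroughZp κ (r k)) →
            Tendsto (fun k ↦ avatarValueAt (r k) γ) atTop (𝓝 1) →
            Tendsto (fun k ↦ ‖((ι'.symm (bdpInterpolationValue p Dt.f
                (primeOfEmbeddingDatum p ι' w₀.embedding) (φ k) (n k) ΩK) : PadicAlgCl p) : ℂ_[p]) *
              Ωp ^ (4 * n k)‖) atTop
              (𝓝 (‖algebraMap ℚ_[p] ℂ_[p] (((1 : ℚ_[p]) - ((W.LFunction p : ℤ) : ℚ_[p]) *
                (p : ℚ_[p])⁻¹) * logOmega W p e P)‖ ^ 2)))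

include hVNall

/-- **Route p2's open input on `R1Population ∩ Locus` from the core + (VN_p)** (pair level, imc-p1's
11 published + 5 cited named facts VERBATIM the hypotheses of p417457's
`openInputOnTreeAt_of_r1Population_of_not_dvd_of_imcDivIntFrameAtErratumData`, through §1's TARGET E).
CONDITIONAL on the named facts, on (VN_p) and on the core shape (OPEN); nothing booked.
[claim: Castella2018Erratum, status: under-review]
[cite: Castella2018, Thms. 2.3, 3.1, 3.2, §5 (arXiv:1704.06608 pp. 5, 9, 12)] [cite: Miller2011LMS, Def. 1.1] -/
theorem openInputOnTreeAt_of_r1Population_of_not_dvd_of_normContinuity_of_core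
    (hGZ86 : GrossZagier1986_thm_I_7_3) (hGZK : rank_eq_analyticRank_of_analyticRank_le_one)
    (hSk : Skinner2016.thmC_padicValRat_bsd_rank_zero) (hnf : exists_isNewformOf)
    (hCST : CaiShuTian2014.thm11_trivialChar)
    (hFH : friedbergHoffstein_exists_twist_ne_zero_ramifiedAt)
    (hMaz : mazur_not_dvd_maninConstant_of_odd)
    (hGZ : ∀ (N : ℕ) [NeZero N] (W : WeierstrassCurve ℚ) (K : Type) [Field K] [NumberField K],
      gross_zagier N W K)
    (hKo : ∀ (N : ℕ) [NeZero N] (W : WeierstrassCurve ℚ) (K : Type) [Field K] [NumberField K],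
      kolyvagin N W K)
    (hB : ∀ (N : ℕ) [NeZero N] (W : WeierstrassCurve ℚ) (K : Type) [Field K] [NumberField K],
      Kolyvagin1990_padicValNat_card_sha_le N W K)
    (hHL : HoffsteinLuo1997_exists_twist_L_one_ne_zero)
    (hPTs : ∀ (K : Type) [Field K] [NumberField K], poitouTate_sum_localTatePairing_eq_zero K)
    (hPT : ∀ (K : Type) [Field K] [NumberField K], poitouTate_selmerStructure_duality K)
    (hPT2 : ∀ (K : Type) [Field K] [NumberField K], poitouTate_sha_tateDual K)
    (hEP : ∀ (K : Type) [Field K] [NumberField K] (v : HeightOneSpectrum (𝓞 K)),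
      localEulerPoincareCharacteristic (v.adicCompletion K))
    (hcd : fieldCdLE_two_of_numberField)
    (h3 : ∀ (W : WeierstrassCurve ℚ) [W.IsElliptic] [W.IsGloballyMinimal] (p : ℕ) [Fact p.Prime],
      P2.IMCDivIntCoreFrameAtErratumData W p) :
    ∀ (W : WeierstrassCurve ℚ) [W.IsElliptic] [W.IsGloballyMinimal] (p : ℕ) [Fact p.Prime],
      R1Population W p → ¬ p ∣ W.tamagawaProduct → P2OpenInputOnTreeAt W p :=
  fun W _ _ p _ hW htam ↦
    openInputOnTreeAt_of_r1Population_of_not_dvd_of_imcDivIntFrameAtErratumData W p hGZ86 hGZK hSk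
      hnf hCST hFH hMaz hGZ hKo hB hHL hPTs hPT hPT2 hEP hcd
      (imcDivIntFrameAtErratumData_of_normContinuity_of_core (hVNall W p) (h3 W p)) hW htam

/-- **Item 19061's glue with the H2 child REPLACED by (VN_p).** `OpenInputIMC` follows from
`IMCDivAtErratumDataAll` (item 19270, H3 core at every pair), `OpenInputRamOffErratumLocus` (19274),
(VN_p) at every pair, `OpenInputNotRam` (19282) and the support conjunction `PublishedInputsIMCReduction`
(19283) — the term of `openInputIMCOfChildren_holds` (p418364's three-way case split + p417457) with
`BDPValueCoreFramesAll` (19275: an `R₀`-frame WITH value at every erratum datum) replaced by the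
frame-free, unit-free, `R₀`-free (VN_p). CONDITIONAL on the four remaining OPEN children; nothing booked.
[claim: Castella2018Erratum, status: under-review]
[cite: Castella2018, Thms. 2.3, 3.1, 3.2, §5 (arXiv:1704.06608 pp. 5, 9, 12)] [cite: Miller2011LMS, Def. 1.1] -/
theorem openInputIMC_of_core_of_ramResidue_of_normContinuity_of_not_ram
    (h3 : ErratumRoadFive.IMCDivAtErratumDataAll) (hRam : ErratumRoadFive.OpenInputRamOffErratumLocus)
    (hOff : ErratumRoadFive.OpenInputNotRam) (hF : ErratumRoadFive.PublishedInputsIMCReduction) :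
    ErratumRoadFive.OpenInputIMC := by
  obtain ⟨hGZ86, hGZK, hSk, hnf, hCST, hFH, hMaz, hGZ, hKo, hB, hHL, hPTs, hPT, hPT2, hEP, hcd⟩ := hF
  exact openInputIMC_of_r1Locus_of_ramResidue_of_not_ram
    (openInputOnTreeAt_of_r1Population_of_not_dvd_of_normContinuity_of_core hVNall hGZ86 hGZK hSk hnf
      hCST hFH hMaz hGZ hKo hB hHL hPTs hPT hPT2 hEP hcd (fun W _ _ p _ ↦ h3 W p))
    (fun W _ _ p _ ↦ hRam W p) (fun W _ _ p _ ↦ hOff W p)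

/-- **Item 19275 from (VN_p ∀) + frame existence (H1∃⁻ ∀)** — §1's second theorem at every pair, in
the route decl's currency. CONDITIONAL; nothing booked.
[cite: Castella2018, Thm. 3.1, display (3.2) and Thm. 3.2 (arXiv:1704.06608 p. 9) (shapes only)] -/
theorem bdpValueCoreFramesAll_of_normContinuity_of_frames
    (hF : ∀ (W : WeierstrassCurve ℚ) [W.IsElliptic] [W.IsGloballyMinimal] (p : ℕ) [Fact p.Prime],
      ∀ [NeZero (W.conductorNorm ℤ)] (q : ℕ) [Fact q.Prime] (K : Type) [Field K] [NumberField K]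
      (Dt : ModularParametrizationData W (W.conductorNorm ℤ))
      (H : HeegnerDatum (W.conductorNorm ℤ) (NumberField.discr K)) (w₀ : InfinitePlace K)
      (P : (W.baseChange K).toAffine.Point), ErratumHypotheses W p → W.analyticRank = 1 →
      q ≠ p → Mult W q → ¬ W.HasSplitMultiplicativeReductionAtPrime q →
      ¬ p ∣ padicValInt q W.minimalDiscriminantInt → IsErratumField W K q →
      Cas20Standing K p (W.conductorNorm ℤ / p) →
      WeierstrassCurve.Affine.Point.map w₀.embedding.toRatAlgHom P = heegnerPointComplex Dt H →
      ¬ (p : ℤ) ∣ Dt.c → ¬ IsOfFinAddOrder P →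
      ∀ (κ : ZpExtension K p), κ.IsAnticyclotomic →
        ∀ (γ : Field.absoluteGaloisGroup K) [Fact (κ.IsTopGenerator γ)] (ι' : PadicAlgCl p ≃+* ℂ)
          (e : K →+* ℚ_[p]),
          (∀ k : 𝓞 K, k ∈ (primeOfEmbeddingDatum p ι' w₀.embedding).asIdeal ↔ ‖e (k : K)‖ < 1) →
          ∃ (ΩK : ℂ) (Ωp : (unrIntegers p)ˣ) (L : UnrSeries p), ΩK ≠ 0 ∧
            IsBDPLFunction ι' (primeOfEmbeddingDatum p ι' w₀.embedding) κ γ Dt.f ΩK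
              ((Ωp : unrIntegers p) : ℂ_[p]) L) :
    ErratumRoadFive.BDPValueCoreFramesAll :=
  fun W _ _ p _ ↦ bdpValueCoreFrameOnTree_of_normContinuity_of_frames (hVNall W p) (hF W p)

end Route

/-- **Item 19275 ⟹ (VN_p ∀)** (§2 at every pair): the statement a restate of item 19275 to (VN_p ∀)
would file is IMPLIED by the item as filed — nothing is lost. [folklore] -/
theorem normContinuity_of_bdpValueCoreFramesAll (h2 : ErratumRoadFive.BDPValueCoreFramesAll) :
    ∀ (W : WeierstrassCurve ℚ) [W.IsElliptic] [W.IsGloballyMinimal] (p : ℕ) [Fact p.Prime],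
    ∀ [NeZero (W.conductorNorm ℤ)] (q : ℕ) [Fact q.Prime] (K : Type) [Field K] [NumberField K]
    (Dt : ModularParametrizationData W (W.conductorNorm ℤ))
    (H : HeegnerDatum (W.conductorNorm ℤ) (NumberField.discr K)) (w₀ : InfinitePlace K)
    (P : (W.baseChange K).toAffine.Point), ErratumHypotheses W p → W.analyticRank = 1 →
    q ≠ p → Mult W q → ¬ W.HasSplitMultiplicativeReductionAtPrime q →
    ¬ p ∣ padicValInt q W.minimalDiscriminantInt → IsErratumField W K q →
    Cas20Standing K p (W.conductorNorm ℤ / p) →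
    WeierstrassCurve.Affine.Point.map w₀.embedding.toRatAlgHom P = heegnerPointComplex Dt H →
    ¬ (p : ℤ) ∣ Dt.c → ¬ IsOfFinAddOrder P →
    ∀ (κ : ZpExtension K p), κ.IsAnticyclotomic →
      ∀ (γ : Field.absoluteGaloisGroup K) [Fact (κ.IsTopGenerator γ)] (ι' : PadicAlgCl p ≃+* ℂ)
        (e : K →+* ℚ_[p]),
        (∀ k : 𝓞 K, k ∈ (primeOfEmbeddingDatum p ι' w₀.embedding).asIdeal ↔ ‖e (k : K)‖ < 1) →
        ∃ (ΩK : ℂ) (Ωp : ℂ_[p]), ΩK ≠ 0 ∧ Ωp ≠ 0 ∧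
          ∀ (φ : ℕ → HeckeCharacter K) (n : ℕ → ℕ) (r : ℕ → FramedGaloisRep K (PadicAlgCl p) 1),
            (∀ k, 0 < n k) → (∀ k (v : HeightOneSpectrum (𝓞 K)), (φ k).IsUnramifiedAt v) →
            (∀ k, (φ k).HasInfinityType (fun _ ↦ (n k : ℤ)) (fun _ ↦ -(n k : ℤ))) →
            (∀ k, IsPAdicAvatarOf ι' (φ k) (r k)) → (∀ k, FactorsThroughZp κ (r k)) →
            Tendsto (fun k ↦ avatarValueAt (r k) γ) atTop (𝓝 1) →
            Tendsto (fun k ↦ ‖((ι'.symm (bdpInterpolationValue p Dt.f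
                (primeOfEmbeddingDatum p ι' w₀.embedding) (φ k) (n k) ΩK) : PadicAlgCl p) : ℂ_[p]) *
              Ωp ^ (4 * n k)‖) atTop
              (𝓝 (‖algebraMap ℚ_[p] ℂ_[p] (((1 : ℚ_[p]) - ((W.LFunction p : ℤ) : ℚ_[p]) *
                (p : ℚ_[p])⁻¹) * logOmega W p e P)‖ ^ 2)) :=
  fun W _ _ p _ ↦ normContinuityAtErratumData_of_valueContinuity
    (valueContinuityAtErratumData_of_bdpValueCoreFrame (h2 W p))

end Summit.BirchSwinnertonDyer.BirchSwinnertonDyer.Theorems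

end
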